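import Literature.AlgebraicGeometry.AbelianSchemes.SerreTwistBaseChange
import Literature.AlgebraicGeometry.AbelianSchemes.SerreTwistLevel
import HarnessLib

/-!
# The Serre twist in COVER orientation: `c := ψ′ : A ⊗_𝒪 𝔟 → A`, `c^*λ = k·λ_𝔟`, `c ∘ σ_𝔟 = σ`
# ([RapoportSmithlingZhang2020Diagonal] §3.2, (4.23); [MumfordAV1970] §7 Thm. 4, §23; [MumfordFogartyKirwan1994] Def. 7.1)

Topic `AlgebraicGeometry/AbelianSchemes`, namespace `Literature.AlgebraicGeometry.AbelianSchemes.AbelianSchemeOver`.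
THEOREMS ONLY (no definition, no named fact, no `instance`, no notation, no `sorry`); ANY base scheme `S` unless stated.
Cell `hodgecm-mathlib`, F0/P6 «MOD», organ (O-γ) «SERRE TWIST OF A PEL FAMILY», part (γ6) «COVER ORIENTATION» (desk F0P6a-plan (g1)
2026-09-01T18:37:47Z: the moduli datum's TWIST law is typed with the COVER `c : A_{γx̄} = A_x̄ ⊗ 𝔞 → A_x̄`, `c^*λ_x̄ = n•λ_{γx̄}`,
`c ∘ σ(γx̄) = σ(x̄)`); over ★ `SerreTwistPolarization` (γ2, p846320), ★ `SerreTwistLevel` (γ3, p846346), ★ `SerreTwistBaseChange` (γ4, p846354).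
`--supports stmt-HodgeConjecture-24832`, count-neutral: HC_CM is proved only modulo the 2 remaining named inputs (hLiu418, h413) until rung 0
closes; this file discharges none of them.

## Mathematics

The cover is `c := ψ′ = serreTranslateInv act E′ hE′ Q : A ⊗_𝒪 𝔟 → A` (★ p845429; `ψ_P ≫ ψ′ = [N]_A`, `ψ′ ≫ ψ_P = [N]_{A⊗𝔟}`).

§1 POLARIZATION.  The cover relation «`c^*λ = k·λ_𝔟`» is the equation `ψ′ ≫ λ ≫ ψ′^∨ = λ_𝔟 ≫ [k]` whose left side IS ★ `serreTwistLamPull`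
(`rfl`).  (P1) `[k]` (`k ≠ 0`) is right-cancellable against homomorphisms out of an abelian scheme (★ `cancel_right_of_comp_eq_pow_id`); hence
(P2) the cover-exact `λ_𝔟` is UNIQUE; (P3) cover-exact with `k` ⟹ `ψ_P`-exact (★ `IsExactTwistPol`) with `c` whenever `c·k = N²`
(`ψ_P ≫ λ^{pull} ≫ ψ_P^∨ = λ ≫ [N²]`, ★ `isExactTwistPol_serreTwistLamPull`, then cancel `[k]`); the converse is ★
`serreTwistLamPull_eq_of_isExactTwistPol`; (P4) the relation base-changes (★ `baseChangeHom_serreTwistLamPull`, ★ `baseChangeHom_mulN`).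

§2 LEVEL.  Cover orientation = PULL-BACK of the level structure along `c`: for a quasi-inverse pair `φ ≫ ψ = [N]_A`, `ψ ≫ φ = [N]_B`
(`N ≠ 0`, `(N, n) = 1`, `1 < n`, `B` commutative) and a level-`n` structure `lvl` on `A` there is a UNIQUE level-`n` structure `lvl_B` on `B`
with `lvl_B.σ i ≫ ψ = lvl.σ i` [MumfordAV1970, §7 Thm. 4]: EXISTENCE — push `lvl` forward along the homomorphism `[M]_A ≫ φ` with
`M·N ≡ 1 (mod n)` (★ `LevelStructure.existsUnique_comp_of_quasiInverse`; `([M] ≫ φ, ψ)` is a quasi-inverse pair with `[M·N]`), then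
`σᵢ ≫ [M] ≫ φ ≫ ψ = σᵢ^{MN} = σᵢ`; UNIQUENESS — `x := σ¹ᵢ (σ²ᵢ)⁻¹` is `n`-torsion (sections of `B` commute) and killed by `ψ`, hence by `N`
(★ `pow_eq_one_of_comp_eq_one_of_comp_eq_pow_id`), so `x = 1` (Mathlib `pow_eq_one_iff_of_coprime`).  Specialised to the Serre cover:
`∃! lvl_𝔞`, `lvl_𝔞.σ i ≫ ψ′ = lvl.σ i`; and the relation base-changes (★ `sectionBaseChange_comp`).

## Contents
* §1 `eq_of_comp_mulN_eq`, `eq_of_serreTwistLamPull_eq_comp_mulN` (P2), `isExactTwistPol_of_serreTwistLamPull_eq_comp_mulN` (P3),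
  `baseChangeHom_comp_mulN_of_serreTwistLamPull_eq` (P4);
* §2 `LevelStructure.eq_of_σ_comp_eq_σ_comp` (uniqueness, generic), `LevelStructure.existsUnique_σ_comp_eq_of_quasiInverse` (generic),
  `LevelStructure.existsUnique_σ_comp_serreTranslateInv_eq` (the Serre cover), `LevelStructure.baseChange_σ_comp_eq_of_σ_comp_eq` (base change).

## References
* [RapoportSmithlingZhang2020Diagonal] M. Rapoport, B. Smithling, W. Zhang, *Arithmetic diagonal cycles on unitary Shimura varieties*, Compositio
  Math. 156 (2020), §3.2, (4.23).
* [MumfordAV1970] D. Mumford, *Abelian Varieties* (1970), §7 Thm. 4 (p. 72), §23 Thm. 2 (p. 231).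
* [MumfordFogartyKirwan1994] D. Mumford, J. Fogarty, F. Kirwan, *GIT*, 3rd ed. (1994), Ch. 7 §1 Def. 7.1 and §2 Def. 7.2 (p. 129).
* [Conrad2004GrossZagier] B. Conrad, *Gross–Zagier revisited*, MSRI Publ. 49 (2004), §7 Thm. 7.5.
-/

noncomputable section

universe u

open CategoryTheory CategoryTheory.Limits AlgebraicGeometry MonoidalCategory CartesianMonoidalCategory
open scoped MonObj

namespace Literature.AlgebraicGeometry.AbelianSchemes

namespace AbelianSchemeOver

set_option backward.isDefEq.respectTransparency false

variable {S : Scheme.{u}} {A B : AbelianSchemeOver S}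

/-! ### §1 The polarization in cover orientation -/

/-- **`[k]` is right-cancellable** (`k ≠ 0`): `x ≫ [k]_B = y ≫ [k]_B ⟹ x = y` for homomorphisms `x y : C → B` out of an abelian scheme
(★ `cancel_right_of_comp_eq_pow_id` with `χ := [k]`, `χ′ := 𝟙`). [cite: MumfordAV1970, §7 Thm. 4 (p. 72)] -/
theorem eq_of_comp_mulN_eq (C : AbelianSchemeOver S) {k : ℕ} (hk : k ≠ 0) (x y : C.X ⟶ B.X) [IsMonHom x] [IsMonHom y]
    (h : x ≫ B.mulN k = y ≫ B.mulN k) : x = y :=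
  cancel_right_of_comp_eq_pow_id C (B.mulN k) (𝟙 B.X) hk (by rw [Category.comp_id, mulN_def]) x y h

section Serre

variable {O : Type*} [CommRing O] (act : A.RingAction O) [IsCommMonObj A.X] {m : ℕ} (E' : Matrix (Fin m) (Fin m) O)
  (hE' : E' * E' = E') (P : Matrix (Fin m) (Fin 1) O) (Q : Matrix (Fin 1) (Fin m) O) {N : ℕ}
  (D : A.DualPair) (Db : (serreTensor act E' hE').DualPair)
  (hD : Nonempty ((Scheme.Modules.pullback (DualPair.unitHatSlice D)).obj D.P ≅ SheafOfModules.unit _))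
  (hDb : Nonempty ((Scheme.Modules.pullback (DualPair.unitHatSlice Db)).obj Db.P ≅ SheafOfModules.unit _))
  (pol : A.Polarization D)

/-- **UNIQUENESS OF THE COVER-EXACT TWISTED POLARIZATION**: two homomorphisms `λ₁ λ₂ : A ⊗ 𝔟 → (A ⊗ 𝔟)^∧` with
`ψ′ ≫ λ ≫ ψ′^∨ = λᵢ ≫ [k]` (`k ≠ 0`; the left side is ★ `serreTwistLamPull`) are equal (§1 (P1)).
[cite: RapoportSmithlingZhang2020Diagonal, §3.2 and (4.23)] [cite: MumfordAV1970, §23 (Thm. 2, p. 231)] -/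
theorem eq_of_serreTwistLamPull_eq_comp_mulN {k : ℕ} (hk : k ≠ 0) {lam₁ lam₂ : (serreTensor act E' hE').X ⟶ Db.hat.X}
    [IsMonHom lam₁] [IsMonHom lam₂] (h₁ : serreTwistLamPull act E' hE' Q D Db pol = lam₁ ≫ Db.hat.mulN k)
    (h₂ : serreTwistLamPull act E' hE' Q D Db pol = lam₂ ≫ Db.hat.mulN k) : lam₁ = lam₂ :=
  eq_of_comp_mulN_eq (serreTensor act E' hE') hk lam₁ lam₂ (h₁.symm.trans h₂)

include hD hDb in
/-- **COVER-EXACT ⟹ `ψ_P`-EXACT**: if `ψ′ ≫ λ ≫ ψ′^∨ = λ′ ≫ [k]` and `c·k = N²` then `ψ_P ≫ λ′ ≫ ψ_P^∨ = λ ≫ [c]` (★ `IsExactTwistPol … c λ′`) —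
`ψ_P ≫ λ^{pull} ≫ ψ_P^∨ = λ ≫ [N²]` (★ `isExactTwistPol_serreTwistLamPull`) and `[k]` cancels (§1 (P1)).  Converse: ★
`serreTwistLamPull_eq_of_isExactTwistPol`. [cite: RapoportSmithlingZhang2020Diagonal, §3.2 and (4.23)] [cite: MumfordAV1970, §23 (Thm. 2, p. 231)] -/
theorem isExactTwistPol_of_serreTwistLamPull_eq_comp_mulN [IsReduced S] [IsLocallyNoetherian S] (hP : E' * P = P) (hQ : Q * E' = Q)
    (hQP : Q * P = Matrix.scalar (Fin 1) (N : O)) {c k : ℕ} (hk : k ≠ 0) (hck : c * k = N ^ 2)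
    {lam' : (serreTensor act E' hE').X ⟶ Db.hat.X} [IsMonHom lam'] (h : serreTwistLamPull act E' hE' Q D Db pol = lam' ≫ Db.hat.mulN k) :
    IsExactTwistPol act E' hE' P D Db pol c lam' := by
  haveI := isMonHom_serreTranslate act E' hE' P
  haveI := pol.isMonHom
  haveI : IsCommMonObj D.hat.X := D.hat.isCommMonObj_of_isReduced_base
  haveI : IsCommMonObj Db.hat.X := Db.hat.isCommMonObj_of_isReduced_base
  haveI : IsMonHom (D.hat.mulN c) := D.hat.isMonHom_mulN c
  haveI : IsMonHom (DualPair.dualIsogenyOver (serreTranslate act E' hE' P) D Db) :=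
    DualPair.isMonHom_dualIsogenyOver (serreTranslate act E' hE' P) D Db hDb hD
  have hpull := isExactTwistPol_serreTwistLamPull act E' hE' P Q D Db hD pol hP hQ hQP
  rw [isExactTwistPol_iff] at hpull ⊢
  rw [h] at hpull
  -- `[k]` commutes past `ψ_P^∨`
  have hkc : Db.hat.mulN k ≫ DualPair.dualIsogenyOver (serreTranslate act E' hE' P) D Db =
      DualPair.dualIsogenyOver (serreTranslate act E' hE' P) D Db ≫ D.hat.mulN k := by
    rw [mulN_def, mulN_def, MonObj.pow_comp, Category.id_comp, MonObj.comp_pow, Category.comp_id]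
  have hsplit : D.hat.mulN (N ^ 2) = D.hat.mulN c ≫ D.hat.mulN k := by
    rw [mulN_def, mulN_def, mulN_def, MonObj.comp_pow, Category.comp_id, ← pow_mul, hck]
  rw [Category.assoc, hkc, hsplit, ← Category.assoc, ← Category.assoc, ← Category.assoc pol.lam] at hpull
  refine eq_of_comp_mulN_eq A hk _ _ ?_
  simpa only [Category.assoc] using hpull

/-- **The cover relation base-changes**: `ψ′ ≫ λ ≫ ψ′^∨ = λ′ ≫ [k]` over `S` gives
`ψ′_{S′} ≫ λ_{S′} ≫ (ψ′_{S′})^∨ = λ′_{S′} ≫ [k]` over `S′` (★ `baseChangeHom_serreTwistLamPull`, ★ `baseChangeHom_mulN`).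
[cite: MumfordFogartyKirwan1994, Ch. 7 §2 Definition 7.2 (p. 129)] [cite: RapoportSmithlingZhang2020Diagonal, §3.2 and (4.23)] -/
theorem baseChangeHom_comp_mulN_of_serreTwistLamPull_eq {S' : Scheme.{u}} (g : S' ⟶ S) {k : ℕ}
    {lam' : (serreTensor act E' hE').X ⟶ Db.hat.X} (h : serreTwistLamPull act E' hE' Q D Db pol = lam' ≫ Db.hat.mulN k) :
    baseChangeHom (serreTranslateInv act E' hE' Q) g ≫ (pol.baseChange g).lam ≫
        @DualPair.dualIsogenyOver _ ((serreTensor act E' hE').baseChange g) (A.baseChange g)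
          (baseChangeHom (serreTranslateInv act E' hE' Q) g)
          (@isMonHom_baseChangeHom _ _ _ _ (serreTranslateInv act E' hE' Q) g (isMonHom_serreTranslateInv act E' hE' Q))
          (Db.baseChange g) (D.baseChange g) =
      baseChangeHom lam' g ≫ (Db.baseChange g).hat.mulN k := by
  have hmap := (Over.pullback g).map_comp lam' (Db.hat.mulN k)
  rw [← baseChangeHom_serreTwistLamPull g act E' hE' Q D Db pol, h,
    show (Db.baseChange g).hat.mulN k = baseChangeHom (Db.hat.mulN k) g from (Db.hat.baseChangeHom_mulN g k).symm]
  exact hmap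

end Serre

/-! ### §2 The level structure in cover orientation (pull-back along the cover) -/

namespace LevelStructure

variable {g n : ℕ}

/-- **Uniqueness of the pulled-back level structure**: if `ψ : B → A` has kernel killed by `N` on points (`ψ ≫ φ = [N]_B`), `(N, n) = 1`
and `B` is commutative, two level-`n` structures on `B` with `lvl₁.σ i ≫ ψ = lvl₂.σ i ≫ ψ` coincide (`σ¹ᵢ(σ²ᵢ)⁻¹` is `n`- and `N`-torsion).
[cite: MumfordAV1970, §7 Thm. 4 (p. 72)] [cite: MumfordFogartyKirwan1994, Ch. 7 §1 Definition 7.1 (p. 129)] -/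
theorem eq_of_σ_comp_eq_σ_comp [IsCommMonObj B.X] {lvl₁ lvl₂ : B.LevelStructure g n} (ψ : B.X ⟶ A.X) (φ : A.X ⟶ B.X)
    [IsMonHom ψ] [IsMonHom φ] {N : ℕ} (hψφ : ψ ≫ φ = (𝟙 B.X) ^ N) (hcop : Nat.Coprime N n)
    (h : ∀ i, lvl₁.σ i ≫ ψ = lvl₂.σ i ≫ ψ) : lvl₁ = lvl₂ := by
  refine ext_σ (funext fun i => ?_)
  have hn : (lvl₁.σ i * (lvl₂.σ i)⁻¹) ^ n = 1 := by
    rw [mul_pow, inv_pow, lvl₁.pow_σ i, lvl₂.pow_σ i, inv_one, mul_one]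
  have hψ : (lvl₁.σ i * (lvl₂.σ i)⁻¹) ≫ ψ = 1 := by
    rw [MonObj.mul_comp, GrpObj.inv_comp, h i, mul_inv_cancel]
  have hN : (lvl₁.σ i * (lvl₂.σ i)⁻¹) ^ N = 1 := pow_eq_one_of_comp_eq_one_of_comp_eq_pow_id ψ φ hψφ _ hψ
  exact mul_inv_eq_one.mp ((pow_eq_one_iff_of_coprime hcop).mp ⟨hN, hn⟩)

/-- **PULL-BACK OF A LEVEL STRUCTURE ALONG A QUASI-INVERTIBLE HOMOMORPHISM OF DEGREE PRIME TO THE LEVEL** ([MumfordAV1970] §7 Thm. 4):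
for `φ ≫ ψ = [N]_A`, `ψ ≫ φ = [N]_B` (`N ≠ 0`, `(N, n) = 1`, `1 < n`, `B` commutative) and a level-`n` structure `lvl` on `A` there is a UNIQUE
level-`n` structure `lvl_B` on `B` with `lvl_B.σ i ≫ ψ = lvl.σ i` (push `lvl` forward along `[M] ≫ φ`, `MN ≡ 1 (n)`, ★
`existsUnique_comp_of_quasiInverse`). [cite: MumfordAV1970, §7 Thm. 4 (p. 72)] [cite: MumfordFogartyKirwan1994, Ch. 7 §1 Definition 7.1 (p. 129)] -/
theorem existsUnique_σ_comp_eq_of_quasiInverse [IsCommMonObj A.X] [IsCommMonObj B.X] (lvl : A.LevelStructure g n)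
    (φ : A.X ⟶ B.X) (ψ : B.X ⟶ A.X) [IsMonHom φ] [IsMonHom ψ] {N : ℕ} (hN : N ≠ 0) (hφψ : φ ≫ ψ = (𝟙 A.X) ^ N)
    (hψφ : ψ ≫ φ = (𝟙 B.X) ^ N) (hcop : Nat.Coprime N n) (hn : 1 < n) :
    ∃! lvlB : B.LevelStructure g n, ∀ i, lvlB.σ i ≫ ψ = lvl.σ i := by
  -- `M` with `N·M ≡ 1 (mod n)`
  obtain ⟨M, -, hM⟩ := Nat.exists_mul_mod_eq_one_of_coprime hcop hn
  have hM0 : M ≠ 0 := by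
    rintro rfl
    rw [mul_zero, Nat.zero_mod] at hM
    exact zero_ne_one hM
  haveI : IsMonHom (A.mulN M) := A.isMonHom_mulN M
  -- the quasi-inverse pair `([M] ≫ φ, ψ)` with `[M·N]`
  have h1 : (A.mulN M ≫ φ) ≫ ψ = (𝟙 A.X) ^ (M * N) := by
    rw [Category.assoc, hφψ, mulN_def, MonObj.comp_pow, Category.comp_id, pow_mul]
  have h2 : ψ ≫ (A.mulN M ≫ φ) = (𝟙 B.X) ^ (M * N) := by
    rw [mulN_def, MonObj.pow_comp, Category.id_comp, MonObj.comp_pow, hψφ, ← pow_mul, mul_comm]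
  have hcop' : Nat.Coprime (M * N) n := by
    refine Nat.coprime_of_mul_modEq_one 1 ?_
    rw [Nat.ModEq, mul_one, mul_comm, hM, Nat.mod_eq_of_lt hn]
  obtain ⟨lvlB, hlvlB, -⟩ := lvl.existsUnique_comp_of_quasiInverse (A.mulN M ≫ φ) ψ (mul_ne_zero hM0 hN) h1 h2 hcop'
  -- `σᵢ ≫ [M] ≫ φ ≫ ψ = σᵢ^{MN} = σᵢ`
  have hMN : M * N = n * (M * N / n) + 1 := by
    have h := Nat.div_add_mod (M * N) n
    rw [mul_comm M N, hM] at h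
    rw [mul_comm M N]
    exact h.symm
  have hσ : ∀ i, lvlB.σ i ≫ ψ = lvl.σ i := fun i => by
    rw [hlvlB i, Category.assoc, h1, MonObj.comp_pow, Category.comp_id, hMN, pow_add, pow_mul, lvl.pow_σ i, one_pow,
      one_mul, pow_one]
  exact ⟨lvlB, hσ, fun lvl' hlvl' => eq_of_σ_comp_eq_σ_comp ψ φ hψφ hcop fun i => (hlvl' i).trans (hσ i).symm⟩

/-- **The pulled-back level relation base-changes**: `lvl_B.σ i ≫ ψ = lvl.σ i ⟹ (lvl_B ×_S S′).σ i ≫ ψ_{S′} = (lvl ×_S S′).σ i`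
(★ `sectionBaseChange_comp`). [cite: MumfordFogartyKirwan1994, Ch. 7 §2 Definition 7.2 (p. 129)] -/
theorem baseChange_σ_comp_eq_of_σ_comp_eq {S' : Scheme.{u}} (g' : S' ⟶ S) {lvl : A.LevelStructure g n} {lvlB : B.LevelStructure g n}
    {ψ : B.X ⟶ A.X} (h : ∀ i, lvlB.σ i ≫ ψ = lvl.σ i) (i : Fin g ⊕ Fin g) :
    (lvlB.baseChange g').σ i ≫ baseChangeHom ψ g' = (lvl.baseChange g').σ i := by
  rw [baseChange_σ, baseChange_σ, ← sectionBaseChange_comp, h i]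

end LevelStructure

section SerreLevel

variable {O : Type*} [CommRing O] (act : A.RingAction O) [IsCommMonObj A.X] {m : ℕ} (E' : Matrix (Fin m) (Fin m) O)
  (hE' : E' * E' = E') (P : Matrix (Fin m) (Fin 1) O) (Q : Matrix (Fin 1) (Fin m) O) {N : ℕ}

/-- **THE LEVEL STRUCTURE OF THE SERRE TWIST IN COVER ORIENTATION** («`c ∘ σ(γx̄) = σ(x̄)`»; [RapoportSmithlingZhang2020Diagonal] §3.2,
[MumfordAV1970] §7 Thm. 4): for `(N, n) = 1`, `1 < n`, a level-`n` structure `lvl` on `A` pulls back UNIQUELY along the cover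
`ψ′ : A ⊗_𝒪 𝔟 → A`: `∃! lvl_𝔞`, `lvl_𝔞.σ i ≫ ψ′ = lvl.σ i`. [cite: RapoportSmithlingZhang2020Diagonal, §3.2 and (4.23)]
[cite: MumfordAV1970, §7 Thm. 4 (p. 72)] [cite: MumfordFogartyKirwan1994, Ch. 7 §1 Definition 7.1 (p. 129)] -/
theorem LevelStructure.existsUnique_σ_comp_serreTranslateInv_eq {g n : ℕ} (lvl : A.LevelStructure g n) (hN : N ≠ 0)
    (hP : E' * P = P) (hQ : Q * E' = Q) (hQP : Q * P = Matrix.scalar (Fin 1) (N : O))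
    (hPQ : P * Q = Matrix.scalar (Fin m) (N : O) * E') (hcop : Nat.Coprime N n) (hn : 1 < n) :
    ∃! lvl𝔞 : (serreTensor act E' hE').LevelStructure g n, ∀ i, lvl𝔞.σ i ≫ serreTranslateInv act E' hE' Q = lvl.σ i :=
  haveI := isCommMonObj_serreTensor act E' hE'
  haveI := isMonHom_serreTranslate act E' hE' P
  haveI := isMonHom_serreTranslateInv act E' hE' Q
  lvl.existsUnique_σ_comp_eq_of_quasiInverse (serreTranslate act E' hE' P) (serreTranslateInv act E' hE' Q) hN
    (serreTranslate_comp_serreTranslateInv act E' hE' P Q hP hQ hQP) (serreTranslateInv_comp_serreTranslate act E' hE' P Q hP hQ hPQ)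
    hcop hn

/-- **Relation with the push-forward orientation** (★ `SerreTwistLevel`): if `lvl′.σ i = lvl.σ i ≫ ψ_P` (push-forward) and
`lvl_𝔞.σ i ≫ ψ′ = lvl.σ i` (pull-back along the cover) then `lvl′.σ i ≫ ψ′ = (lvl_𝔞.σ i ≫ ψ′) ^ N` — the two differ by the automorphism
`[N]` of the `n`-torsion. [cite: MumfordAV1970, §7 Thm. 4 (p. 72)] [cite: Conrad2004GrossZagier, §7 (Thm. 7.5)] -/
theorem LevelStructure.σ_comp_serreTranslateInv_eq_pow_of_cover {g n : ℕ} {lvl : A.LevelStructure g n}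
    {lvl' lvl𝔞 : (serreTensor act E' hE').LevelStructure g n} (h' : ∀ i, lvl'.σ i = lvl.σ i ≫ serreTranslate act E' hE' P)
    (h𝔞 : ∀ i, lvl𝔞.σ i ≫ serreTranslateInv act E' hE' Q = lvl.σ i) (hP : E' * P = P) (hQ : Q * E' = Q)
    (hQP : Q * P = Matrix.scalar (Fin 1) (N : O)) (i : Fin g ⊕ Fin g) :
    lvl'.σ i ≫ serreTranslateInv act E' hE' Q = (lvl𝔞.σ i ≫ serreTranslateInv act E' hE' Q) ^ N := by
  rw [h𝔞 i]
  exact LevelStructure.σ_comp_serreTranslateInv_of_σ_eq_comp_serreTranslate act E' hE' P Q h' hP hQ hQP i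

end SerreLevel

end AbelianSchemeOver

end Literature.AlgebraicGeometry.AbelianSchemes

end
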